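import Summits.Schanuel.Schanuel.Theorems.SoloInformedX193EvalDet
import Summits.Schanuel.Schanuel.Theorems.SoloInformedX193UnitCircle
import Summits.Schanuel.Schanuel.Theorems.SoloInformedX193Resultant
import Literature.NumberTheory.Transcendental.GelfondCriterion

/-!
# X193 kernel, layer C (F15): Roy's Proposition 3.1 at `t = 1` for a coprime pair, IN THE TREE

Solo-informed Schanuel programme, X193 kernel (DESIGN `work/s213/X193-KERNEL-DESIGN.md`,
Amendment A17).  This file proves, with no hypothesis, the only instance of the named fact
`Literature.NumberTheory.Transcendental.Roy2010.prop_3_1` (D. Roy, *Small value estimates for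
the additive group*, Int. J. Number Theory 6 (2010), Proposition 3.1) that the X193 kernel
uses (`soloX_p31_coprime` of F10a, `SoloInformedX193Resultant`): `t = 1`, `Q = 1`.

* `soloX_vandermonde_le_values_aux` (Roy's Lemmas 3.4–3.6 at `t = 1`, re-cut): for complex
  `p, q ≠ 0` with `‖Res (p, q)‖ ≥ 1` and `s` points `ξ_r` at which `‖p‖ ≤ ‖p‖_∞ V_r`,
  `‖q‖ ≤ ‖q‖_∞ V_r`:  `‖det Vandermonde ξ‖ ≤ N₀! ‖q‖_∞^{deg p} ‖p‖_∞^{deg q}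
  ∏_r (1 + ‖ξ_r‖)^{N₀} V_r` for any `N₀ ≥ max (deg p + deg q, s)`.  When `s ≤ deg p + deg q`
  this is the evaluation-determinant bound of F13 with `deg p + deg q - s` coefficient rows;
  when `s > deg p + deg q`, `p` is replaced by `(X - z)^ℓ p` with `z` the point of the unit
  circle of F14 (`‖q (z)‖ ≥ ‖q‖_∞`), NO coefficient rows remain, the new columns are still
  scaled by `‖p‖_∞` (so no height inequality for the padded polynomial is needed), and
  `Res ((X - z)^ℓ p, q) = q(z)^ℓ Res (p, q)` cancels the `ℓ` extra `q`-columns;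
* `soloX_deltaCap_eq_norm_det`: Roy's `Δ_E` is `‖det Vandermonde‖` of an enumeration of `E`;
* `soloX_res_coprime`: the statement of `soloX_p31_coprime` with the hypotheses
  `(hP31 : prop_3_1)`, `gcd F G = 1`, `G` primitive replaced by `Irreducible F`, `¬ F ∣ G`:
  `1 ≤ c₁ (n, s, 1, E) ‖F‖^{deg G} ‖G‖^{deg F} ∏_{z ∈ E} V z` (constants absorbed by
  `(2n)! ≤ e^{7n²}` and `(1 + c_E)^{2ns} ≤ (2 + c_E)^{4ns}`).

No definitions.
-/

namespace Summit.Schanuel.Schanuel.Theorems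

open Polynomial Finset Matrix
open Literature.NumberTheory.Transcendental.Roy2010

/-! ## The Vandermonde determinant against the values of a coprime pair -/

/-- **Roy's Lemmas 3.4–3.6 at `t = 1`, bound form.**  `p, q ∈ ℂ[X]` nonzero with
`‖Res (p, q)‖ ≥ 1`; `ξ` any `s` points with `‖p (ξ_r)‖ ≤ ‖p‖_∞ V_r`, `‖q (ξ_r)‖ ≤ ‖q‖_∞ V_r`;
`N₀ ≥ deg p + deg q` and `N₀ ≥ s`.  Then
`‖det Vandermonde ξ‖ ≤ N₀! (‖q‖_∞ ^ deg p · ‖p‖_∞ ^ deg q) ∏_r (1 + ‖ξ_r‖) ^ N₀ V_r`. -/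
theorem soloX_vandermonde_le_values_aux {p q : ℂ[X]} (hp0 : p ≠ 0) (hq0 : q ≠ 0)
    (hres : 1 ≤ ‖resultant p q‖) {s N₀ : ℕ} (ξ : Fin s → ℂ) {V : Fin s → ℝ}
    (hVp : ∀ r, ‖p.eval (ξ r)‖ ≤ p.supNorm * V r)
    (hVq : ∀ r, ‖q.eval (ξ r)‖ ≤ q.supNorm * V r)
    (hdeg : p.natDegree + q.natDegree ≤ N₀) (hs : s ≤ N₀) :
    ‖(vandermonde ξ).det‖ ≤
      N₀.factorial * (q.supNorm ^ p.natDegree * p.supNorm ^ q.natDegree) *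
        ∏ r, (1 + ‖ξ r‖) ^ N₀ * V r := by
  have hcp : 0 < p.supNorm :=
    lt_of_le_of_ne p.supNorm_nonneg (fun h => hp0 ((supNorm_eq_zero_iff p).mp h.symm))
  have hcq : 0 < q.supNorm :=
    lt_of_le_of_ne q.supNorm_nonneg (fun h => hq0 ((supNorm_eq_zero_iff q).mp h.symm))
  have hV0 : ∀ r, 0 ≤ V r := fun r =>
    le_of_mul_le_mul_left ((mul_zero _).le.trans ((norm_nonneg _).trans (hVp r))) hcp
  have hpow : ∀ (x : ℂ) {j : ℕ}, j ≤ N₀ → ‖x‖ ^ j ≤ (1 + ‖x‖) ^ N₀ := fun x j hj =>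
    (pow_le_pow_left₀ (norm_nonneg x) (le_add_of_nonneg_left zero_le_one) j).trans
      (pow_le_pow_right₀ (le_add_of_nonneg_right (norm_nonneg x)) hj)
  have hqev : ∀ r, ∀ j : ℕ, j ≤ N₀ →
      ‖ξ r ^ j * q.eval (ξ r)‖ ≤ (1 + ‖ξ r‖) ^ N₀ * V r * q.supNorm := by
    intro r j hj
    rw [norm_mul, norm_pow]
    calc ‖ξ r‖ ^ j * ‖q.eval (ξ r)‖ ≤ (1 + ‖ξ r‖) ^ N₀ * (q.supNorm * V r) :=
          mul_le_mul (hpow _ hj) (hVq r) (norm_nonneg _) (by positivity)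
      _ = (1 + ‖ξ r‖) ^ N₀ * V r * q.supNorm := by ring
  have hpev : ∀ r, ∀ j : ℕ, j ≤ N₀ →
      ‖ξ r ^ j * p.eval (ξ r)‖ ≤ (1 + ‖ξ r‖) ^ N₀ * V r * p.supNorm := by
    intro r j hj
    rw [norm_mul, norm_pow]
    calc ‖ξ r‖ ^ j * ‖p.eval (ξ r)‖ ≤ (1 + ‖ξ r‖) ^ N₀ * (p.supNorm * V r) :=
          mul_le_mul (hpow _ hj) (hVp r) (norm_nonneg _) (by positivity)
      _ = (1 + ‖ξ r‖) ^ N₀ * V r * p.supNorm := by ring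
  have hρ0 : 0 ≤ ∏ r, (1 + ‖ξ r‖) ^ N₀ * V r :=
    Finset.prod_nonneg fun r _ => mul_nonneg (by positivity) (hV0 r)
  have hG0 : 0 ≤ q.supNorm ^ p.natDegree * p.supNorm ^ q.natDegree := by positivity
  rcases Nat.lt_or_ge (p.natDegree + q.natDegree) s with hsmn | hsmn
  · -- Case `s > deg p + deg q`: pad `p` by `(X - z)^ℓ`, `‖q (z)‖ ≥ ‖q‖_∞`, `‖z‖ = 1`.
    obtain ⟨z, hz1, hzc⟩ := soloX_exists_norm_eval_ge_coeff q
    have hqz : q.supNorm ≤ ‖q.eval z‖ := by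
      obtain ⟨i, hi⟩ := q.exists_eq_supNorm
      rw [hi]
      exact hzc i
    obtain ⟨ℓ, hℓs⟩ : ∃ ℓ, ℓ + p.natDegree + q.natDegree = s :=
      ⟨s - (p.natDegree + q.natDegree), by omega⟩
    have hXl : ((X - C z) ^ ℓ : ℂ[X]).natDegree = ℓ := by
      rw [natDegree_pow, natDegree_X_sub_C, mul_one]
    have hpt : ((X - C z) ^ ℓ * p).natDegree ≤ ℓ + p.natDegree :=
      natDegree_mul_le.trans (by rw [hXl])
    have hk : s + 0 = (ℓ + p.natDegree) + q.natDegree := by omega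
    have hpev' : ∀ r, ∀ j : ℕ, j < q.natDegree →
        ‖ξ r ^ j * ((X - C z) ^ ℓ * p).eval (ξ r)‖ ≤ (1 + ‖ξ r‖) ^ N₀ * V r * p.supNorm := by
      intro r j hj
      rw [eval_mul, eval_pow, eval_sub, eval_X, eval_C, norm_mul, norm_mul, norm_pow, norm_pow]
      have h1 : ‖ξ r - z‖ ^ ℓ ≤ (1 + ‖ξ r‖) ^ ℓ := by
        refine pow_le_pow_left₀ (norm_nonneg _) ?_ ℓ
        calc ‖ξ r - z‖ ≤ ‖ξ r‖ + ‖z‖ := norm_sub_le _ _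
          _ = 1 + ‖ξ r‖ := by rw [hz1, add_comm]
      have h2 : ‖ξ r‖ ^ j * ‖ξ r - z‖ ^ ℓ ≤ (1 + ‖ξ r‖) ^ N₀ := by
        calc ‖ξ r‖ ^ j * ‖ξ r - z‖ ^ ℓ ≤ (1 + ‖ξ r‖) ^ j * (1 + ‖ξ r‖) ^ ℓ :=
              mul_le_mul (pow_le_pow_left₀ (norm_nonneg _)
                (le_add_of_nonneg_left zero_le_one) j) h1 (by positivity) (by positivity)
          _ = (1 + ‖ξ r‖) ^ (j + ℓ) := (pow_add _ _ _).symm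
          _ ≤ (1 + ‖ξ r‖) ^ N₀ :=
              pow_le_pow_right₀ (le_add_of_nonneg_right (norm_nonneg _)) (by omega)
      calc ‖ξ r‖ ^ j * (‖ξ r - z‖ ^ ℓ * ‖p.eval (ξ r)‖)
          = (‖ξ r‖ ^ j * ‖ξ r - z‖ ^ ℓ) * ‖p.eval (ξ r)‖ := by ring
        _ ≤ (1 + ‖ξ r‖) ^ N₀ * (p.supNorm * V r) :=
            mul_le_mul h2 (hVp r) (norm_nonneg _) (by positivity)
        _ = (1 + ‖ξ r‖) ^ N₀ * V r * p.supNorm := by ring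
    have hmain := soloX_vandermonde_resultant_le ((X - C z) ^ ℓ * p) q hpt le_rfl hk ξ
      (ρ := fun r => (1 + ‖ξ r‖) ^ N₀ * V r) hcp.le hcq.le zero_le_one
      (fun r j hj => hqev r j (by omega)) hpev' (fun h => absurd rfl h) (fun h => absurd rfl h)
    rw [pow_zero, mul_one] at hmain
    have hfac : resultant ((X - C z) ^ ℓ * p) q (ℓ + p.natDegree) q.natDegree =
        q.eval z ^ ℓ * resultant p q := by
      have h := resultant_mul_left ((X - C z) ^ ℓ) p q q.natDegree le_rfl
      rw [hXl, resultant_X_sub_C_pow_left z q ℓ q.natDegree le_rfl] at h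
      exact h
    have hres' : q.supNorm ^ ℓ ≤
        ‖resultant ((X - C z) ^ ℓ * p) q (ℓ + p.natDegree) q.natDegree‖ := by
      rw [hfac, norm_mul, norm_pow]
      calc q.supNorm ^ ℓ = q.supNorm ^ ℓ * 1 := (mul_one _).symm
        _ ≤ ‖q.eval z‖ ^ ℓ * ‖resultant p q‖ :=
            mul_le_mul (pow_le_pow_left₀ hcq.le hqz ℓ) hres zero_le_one (by positivity)
    have hfin : ‖(vandermonde ξ).det‖ * q.supNorm ^ ℓ ≤
        (N₀.factorial * (q.supNorm ^ p.natDegree * p.supNorm ^ q.natDegree) *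
          ∏ r, (1 + ‖ξ r‖) ^ N₀ * V r) * q.supNorm ^ ℓ := by
      calc ‖(vandermonde ξ).det‖ * q.supNorm ^ ℓ
          ≤ ‖(vandermonde ξ).det‖ *
              ‖resultant ((X - C z) ^ ℓ * p) q (ℓ + p.natDegree) q.natDegree‖ :=
            mul_le_mul_of_nonneg_left hres' (norm_nonneg _)
        _ ≤ (ℓ + p.natDegree + q.natDegree).factorial *
              ((∏ r, (1 + ‖ξ r‖) ^ N₀ * V r) *
                (q.supNorm ^ (ℓ + p.natDegree) * p.supNorm ^ q.natDegree)) := hmain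
        _ ≤ N₀.factorial *
              ((∏ r, (1 + ‖ξ r‖) ^ N₀ * V r) *
                (q.supNorm ^ (ℓ + p.natDegree) * p.supNorm ^ q.natDegree)) :=
            mul_le_mul_of_nonneg_right (Nat.cast_le.mpr (Nat.factorial_le (by omega)))
              (mul_nonneg hρ0 (by positivity))
        _ = _ := by ring
    exact le_of_mul_le_mul_right hfin (pow_pos hcq ℓ)
  · -- Case `s ≤ deg p + deg q`: `deg p + deg q - s` coefficient rows remain.
    obtain ⟨k, hk⟩ : ∃ k, s + k = p.natDegree + q.natDegree := ⟨_, Nat.add_sub_cancel' hsmn⟩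
    have hmain := soloX_vandermonde_resultant_le p q le_rfl le_rfl hk ξ
      (ρ := fun r => (1 + ‖ξ r‖) ^ N₀ * V r) hcp.le hcq.le zero_le_one
      (fun r j hj => hqev r j (by omega)) (fun r j hj => hpev r j (by omega))
      (fun _ i => by rw [one_mul]; exact q.le_supNorm i)
      (fun _ i => by rw [one_mul]; exact p.le_supNorm i)
    rw [one_pow, mul_one] at hmain
    calc ‖(vandermonde ξ).det‖ ≤ ‖(vandermonde ξ).det‖ * ‖resultant p q‖ :=
          le_mul_of_one_le_right (norm_nonneg _) hres
      _ ≤ (p.natDegree + q.natDegree).factorial *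
            ((∏ r, (1 + ‖ξ r‖) ^ N₀ * V r) *
              (q.supNorm ^ p.natDegree * p.supNorm ^ q.natDegree)) := hmain
      _ ≤ N₀.factorial *
            ((∏ r, (1 + ‖ξ r‖) ^ N₀ * V r) *
              (q.supNorm ^ p.natDegree * p.supNorm ^ q.natDegree)) :=
          mul_le_mul_of_nonneg_right (Nat.cast_le.mpr (Nat.factorial_le hdeg))
            (mul_nonneg hρ0 hG0)
      _ = _ := by ring

/-! ## Transport: integer polynomials, the set `E`, Roy's constants -/

/-- The sup norm is unchanged by `ℤ[X] → ℂ[X]`. -/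
theorem soloX_supNorm_map_intCast (F : ℤ[X]) : (F.map (algebraMap ℤ ℂ)).supNorm = F.supNorm := by
  rw [supNorm_eq_iSup, supNorm_eq_iSup]
  refine iSup_congr fun i => ?_
  rw [coeff_map, eq_intCast, Complex.norm_intCast, Int.norm_eq_abs]

/-- `‖z‖ ≤ c_E` for `z ∈ E`. -/
theorem soloX_norm_le_cMax {E : Finset ℂ} {z : ℂ} (hz : z ∈ E) : ‖z‖ ≤ cMax E := by
  unfold cMax
  have h : ‖z‖₊ ≤ E.sup fun w => ‖w‖₊ := Finset.le_sup (f := fun w => ‖w‖₊) hz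
  have h' := NNReal.coe_le_coe.mpr h
  simpa using h'

/-- Roy's `Δ_E` is `‖det Vandermonde ξ‖` for the enumeration `ξ = E.equivFin.symm` of `E`. -/
theorem soloX_deltaCap_eq_norm_det (E : Finset ℂ) :
    deltaCap E =
      ‖(vandermonde fun r : Fin E.card => ((E.equivFin.symm r : E) : ℂ)).det‖ := by
  rw [← soloX_prod_offDiag_sqrt_eq]
  unfold deltaCap
  symm
  refine Finset.prod_bij'
    (fun x _ => (((E.equivFin.symm x.1 : E) : ℂ), ((E.equivFin.symm x.2 : E) : ℂ)))
    (fun p hp => (E.equivFin ⟨p.1, (Finset.mem_offDiag.mp hp).1⟩,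
      E.equivFin ⟨p.2, (Finset.mem_offDiag.mp hp).2.1⟩)) ?_ ?_ ?_ ?_ (fun x _ => rfl)
  · intro x hx
    simp only [Finset.mem_offDiag, Finset.mem_univ, true_and] at hx
    exact Finset.mem_offDiag.mpr ⟨(E.equivFin.symm x.1).2, (E.equivFin.symm x.2).2,
      fun h => hx (E.equivFin.symm.injective (Subtype.ext h))⟩
  · intro p hp
    simp only [Finset.mem_offDiag, Finset.mem_univ, true_and]
    exact fun h => (Finset.mem_offDiag.mp hp).2.2 (congrArg Subtype.val (E.equivFin.injective h))
  · intro x hx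
    ext <;> simp
  · intro p hp
    ext <;> simp

/-- `(2n)! ≤ e^{7n²}`. -/
theorem soloX_factorial_two_mul_le_exp (n : ℕ) :
    ((2 * n).factorial : ℝ) ≤ Real.exp (7 * (n : ℝ) ^ 2) := by
  rcases Nat.eq_zero_or_pos n with rfl | hn
  · simp
  have hx : (0 : ℝ) < ((2 * n : ℕ) : ℝ) := by positivity
  have h1 : ((2 * n).factorial : ℝ) ≤ ((2 * n : ℕ) : ℝ) ^ (2 * n) := by
    exact_mod_cast Nat.factorial_le_pow (2 * n)
  have h2 : ((2 * n : ℕ) : ℝ) ^ (2 * n) ≤ Real.exp (7 * (n : ℝ) ^ 2) := by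
    rw [← Real.exp_log hx, ← Real.exp_nat_mul, Real.exp_le_exp]
    have hlog : Real.log ((2 * n : ℕ) : ℝ) ≤ ((2 * n : ℕ) : ℝ) - 1 := Real.log_le_sub_one_of_pos hx
    have hn1 : (1 : ℝ) ≤ n := by exact_mod_cast hn
    push_cast at hlog ⊢
    nlinarith
  exact h1.trans h2

/-- **Roy's Proposition 3.1 at `t = 1` for a coprime pair, unconditionally.**  If
`F, G ∈ ℤ[X]` with `F` irreducible and primitive, `F ∤ G`, `G ≠ 0`, degrees `≤ n`, `E` a set
of `s` points, `0 < s ≤ n`, and `V z` bounds both `‖F(z)‖ / ‖F‖` and `‖G(z)‖ / ‖G‖` on `E`,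
then `1 ≤ c₁ (n, s, 1, E) · ‖F‖ ^ (deg G) · ‖G‖ ^ (deg F) · ∏_{z ∈ E} V z` — the statement of
`soloX_p31_coprime` without the hypothesis `prop_3_1` ([Roy2010, Prop 3.1] at `t = 1`). -/
theorem soloX_res_coprime {F G : ℤ[X]} (hFirr : Irreducible F) (hFp : F.IsPrimitive)
    (hndvd : ¬ F ∣ G) (hG : G ≠ 0) {s n : ℕ} (hs : 0 < s) (hsn : s ≤ n)
    (hFn : F.natDegree ≤ n) (hGn : G.natDegree ≤ n) {E : Finset ℂ} (hE : E.card = s)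
    {V : ℂ → ℝ}
    (hV : ∀ z ∈ E, ‖aeval z F‖ / F.supNorm ≤ V z ∧ ‖aeval z G‖ / G.supNorm ≤ V z) :
    1 ≤ c₁ n s 1 E * F.supNorm ^ G.natDegree * G.supNorm ^ F.natDegree * ∏ z ∈ E, V z := by
  subst hE
  have hF : F ≠ 0 := hFirr.ne_zero
  have hF1 : 1 ≤ F.supNorm := one_le_supNorm_of_ne_zero hF
  have hG1 : 1 ≤ G.supNorm := one_le_supNorm_of_ne_zero hG
  have hinj : Function.Injective (algebraMap ℤ ℂ) := (algebraMap ℤ ℂ).injective_int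
  have hp0 : F.map (algebraMap ℤ ℂ) ≠ 0 := (Polynomial.map_ne_zero_iff hinj).mpr hF
  have hq0 : G.map (algebraMap ℤ ℂ) ≠ 0 := (Polynomial.map_ne_zero_iff hinj).mpr hG
  have hdF : (F.map (algebraMap ℤ ℂ)).natDegree = F.natDegree :=
    natDegree_map_eq_of_injective hinj F
  have hdG : (G.map (algebraMap ℤ ℂ)).natDegree = G.natDegree :=
    natDegree_map_eq_of_injective hinj G
  have hres : 1 ≤ ‖resultant (F.map (algebraMap ℤ ℂ)) (G.map (algebraMap ℤ ℂ))‖ := by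
    rw [hdF, hdG, soloX_resultant_map_intCast]
    exact soloX_one_le_norm_resultant hFirr hFp hndvd
  -- the enumeration of `E` and the values
  set ξ : Fin E.card → ℂ := fun r => ((E.equivFin.symm r : E) : ℂ) with hξ
  have hξE : ∀ r, ξ r ∈ E := fun r => (E.equivFin.symm r).2
  have hV0 : ∀ z ∈ E, 0 ≤ V z := fun z hz =>
    (div_nonneg (norm_nonneg _) F.supNorm_nonneg).trans (hV z hz).1
  have hVp : ∀ r, ‖(F.map (algebraMap ℤ ℂ)).eval (ξ r)‖ ≤
      (F.map (algebraMap ℤ ℂ)).supNorm * V (ξ r) := fun r => by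
    rw [eval_map_algebraMap, soloX_supNorm_map_intCast, mul_comm]
    exact (div_le_iff₀ (by linarith)).mp (hV _ (hξE r)).1
  have hVq : ∀ r, ‖(G.map (algebraMap ℤ ℂ)).eval (ξ r)‖ ≤
      (G.map (algebraMap ℤ ℂ)).supNorm * V (ξ r) := fun r => by
    rw [eval_map_algebraMap, soloX_supNorm_map_intCast, mul_comm]
    exact (div_le_iff₀ (by linarith)).mp (hV _ (hξE r)).2
  have haux := soloX_vandermonde_le_values_aux hp0 hq0 hres ξ (N₀ := 2 * n) hVp hVq
    (by rw [hdF, hdG]; omega) (by omega)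
  rw [hdF, hdG, soloX_supNorm_map_intCast, soloX_supNorm_map_intCast,
    ← soloX_deltaCap_eq_norm_det] at haux
  -- haux : Δ_E ≤ (2n)! (‖G‖^{deg F} ‖F‖^{deg G}) ∏_r (1 + ‖ξ_r‖)^{2n} V (ξ_r)
  have hc0 : 0 ≤ cMax E := soloPT_cMax_nonneg E
  have hprodV : ∏ r, V (ξ r) = ∏ z ∈ E, V z := by
    calc ∏ r, V (ξ r) = ∏ x : E, V (x : ℂ) := Equiv.prod_comp E.equivFin.symm (fun x : E => V x)
      _ = ∏ z ∈ E, V z := Finset.prod_coe_sort (s := E) (f := V)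
  have hprod : ∏ r, (1 + ‖ξ r‖) ^ (2 * n) * V (ξ r) ≤
      (2 + cMax E) ^ (4 * n * E.card * 1) * ∏ z ∈ E, V z := by
    rw [Finset.prod_mul_distrib, hprodV]
    refine mul_le_mul_of_nonneg_right ?_ (Finset.prod_nonneg fun z hz => hV0 z hz)
    calc ∏ r, (1 + ‖ξ r‖) ^ (2 * n) ≤ ∏ _r : Fin E.card, (2 + cMax E) ^ (2 * n) :=
          Finset.prod_le_prod (fun r _ => by positivity) fun r _ =>
            pow_le_pow_left₀ (by positivity)
              (by linarith [soloX_norm_le_cMax (hξE r)]) _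
      _ = (2 + cMax E) ^ (2 * n * E.card) := by
          rw [Finset.prod_const, Finset.card_univ, Fintype.card_fin, ← pow_mul]
      _ ≤ (2 + cMax E) ^ (4 * n * E.card * 1) :=
          pow_le_pow_right₀ (by linarith) (by nlinarith)
  have hfact := soloX_factorial_two_mul_le_exp n
  have hH : 0 ≤ G.supNorm ^ F.natDegree * F.supNorm ^ G.natDegree := by positivity
  have hPV : 0 ≤ ∏ z ∈ E, V z := Finset.prod_nonneg fun z hz => hV0 z hz
  have hΔ : deltaCap E ≤ Real.exp (7 * (n : ℝ) ^ 2) * (2 + cMax E) ^ (4 * n * E.card * 1) *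
      F.supNorm ^ G.natDegree * G.supNorm ^ F.natDegree * ∏ z ∈ E, V z := by
    calc deltaCap E
        ≤ ((2 * n).factorial : ℝ) * (G.supNorm ^ F.natDegree * F.supNorm ^ G.natDegree) *
          ∏ r, (1 + ‖ξ r‖) ^ (2 * n) * V (ξ r) := haux
      _ ≤ Real.exp (7 * (n : ℝ) ^ 2) * (G.supNorm ^ F.natDegree * F.supNorm ^ G.natDegree) *
          ((2 + cMax E) ^ (4 * n * E.card * 1) * ∏ z ∈ E, V z) := by
          refine mul_le_mul (mul_le_mul_of_nonneg_right hfact hH) hprod ?_ (by positivity)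
          exact Finset.prod_nonneg fun r _ => mul_nonneg (by positivity) (hV0 _ (hξE r))
      _ = _ := by ring
  simp only [c₁, one_pow, pow_one]
  rw [div_mul_eq_mul_div, div_mul_eq_mul_div, div_mul_eq_mul_div,
    one_le_div (soloX_deltaCap_pos E)]
  exact hΔ

end Summit.Schanuel.Schanuel.Theorems
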